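import Summits.QuantumFields.YangMills.Theorems.UnitScaleTiltProp7ExistRouteAlphaMinG
import HarnessLib

/-!
# Route `UnitScaleTilt`, crux K1 child «MinimiserStabilityRegPr» (stmt-QuantumFields-19200), skeleton v10, stub `stub_existenceMinimalOrbit` (EX), route (α) —
# (T1) «SPINE-CTR»: **THE SED-TWIN OF THE ROUTE (α) SPINE ✓`Prop7ExistRouteAlphaMinG.existenceMinimalOrbit_of_CminG_cov` WITH THE LIFT ANTECEDENT `Lift i U₀ →` IN C-minˢ AND THE
# RE-CENTRING ROW `hSymCentre`** (EX namer ★w2-19200 g6 S7′ DESIGN 2026-08-28T21:50:04Z: «WHERE the given `U₀` becomes the chart centre = THE SPINE … the stub's conclusion does not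
# mention `U₀` ⇒ re-centring at the TOP is one line»)

Cell `ym3-torus`, width seat `ym3-torus-px14` (gen 2; pen (T1)+(T2)).  THEOREMS ONLY (0 `def`, 0 `sorry`).  `--supports stmt-QuantumFields-19200 --as helper`, count-neutral.  YM₃ on T³ is
a ladder rung (R3), not the Clay problem; nothing here claims the stub, the crux, d = 4 or the mass gap.

WHY ∕ HOW.  The spine applies its two inputs C-minˢ (`hC`) and COV (`hV`) AT a chart centre; every row above the spine is `∀ U₀` under `RegPr`∕`CloseAvg`, and the stub's conclusion
(`∃ U ∈ regFibrePr (O₁L³B₃ε₁) V, IsMinOn …`) does not mention the centre.  In the S7′ chain C-minˢ carries the extra antecedent `Lift i U₀ →` (twin (T2) ✓`Prop7CminOfP6T3PdWECtr`),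
so the spine must choose a centre that HAS the lift: the new displayed row **`hSymCentre`** — for every member, `ε₁ ≤ aS`, plaquette-small `V` and any `U₀ ∈ 𝔅_k(V)` with
`RegPr (L³B₃ε₁) U₀`, there is `U₀* ∈ 𝔅_k(V)` with `RegPr (L³B₃ε₁) U₀*` AND `Lift i U₀*` (ONE radius, the rows' `L³B₃ε₁`; SYM-CENTRE lineage, px20) — and the proof is
✓`existenceMinimalOrbit_of_CminG_cov`'s VERBATIM after `obtain ⟨U₀*, …⟩ := hSymCentre …` (the old `U₀` is simply replaced by `U₀*`; `a₁′ ↦ min a₁′ aS`; `hC` receives `Lift i U₀*`).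
`Lift` is an OPAQUE member-indexed predicate (binder like `Lan`), so this twin is independent of the final `hLift` text (✓`hHZ_of_parallelLift`'s binder, KNIT-FINAL lineage).
WHAT IS PROVED: ★★ `existenceMinimalOrbit_of_CminG_covCtr` — conclusion = the spine's (= `stub_existenceMinimalOrbit`'s body at `(L, B₃)`) VERBATIM.
HONEST SCOPE: bookkeeping twin; `hSymCentre` and the lift-threaded C-minˢ are DISPLAYED; nothing of print asserted beyond the original; the stub is not closed.

References: T. Bałaban, CMP 102 (1985) 277–309 [Balaban1985Variational] (Prop. 7 p.299, (112) p.294, (116) p.295, (141)–(142) p.299); CMP 99 (1985) 75–102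
[Balaban1985RegularSpaces] (Thm 2 p.83, (1.19) p.79, (1.28)–(1.30) p.81).
-/

set_option autoImplicit false

noncomputable section

open scoped Matrix.Norms.L2Operator

namespace Summit.QuantumFields.YangMills.Theorems.Prop7ExistRouteAlphaMinGCtr

open Literature.MathematicalPhysics.QuantumFieldTheory.Balaban1983to89
open Literature.MathematicalPhysics.QuantumFieldTheory.Balaban1983to89.T3ContinuumYM3Torus
open Literature.MathematicalPhysics.QuantumFieldTheory.Balaban1983to89.T3UnitLawDensityEML (ℰp)
open Literature.MathematicalPhysics.QuantumFieldTheory.Balaban1983to89.T3DescentFibreTower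
open Literature.MathematicalPhysics.QuantumFieldTheory.Balaban1983to89.T3ConstrainedMinimiser
open Literature.MathematicalPhysics.QuantumFieldTheory.Balaban1983to89.T3TiltDescent
open Literature.MathematicalPhysics.QuantumFieldTheory.Balaban1983to89.T3PrintedRegularMinimiser
open Literature.MathematicalPhysics.QuantumFieldTheory.Balaban1983to89.T3PrintedMinimiserExistence (regPr_mono)
open Literature.MathematicalPhysics.QuantumFieldTheory.Balaban1983to89.T3PrintedRegularOrbits (descTransf regPr_gaugeAct_iff gaugeAct_mem_regFibrePr_iff_of_trivial)
open Literature.MathematicalPhysics.QuantumFieldTheory.Balaban1983to89.T3Thm1Carrier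
open Literature.MathematicalPhysics.QuantumFieldTheory.Balaban1983to89.T3SectALandauChart
open B7Prop2Explicit (C0 c2' C0_pos c2'_pos)
open B8Thm4TorusAt (torusLam)
open Summit.QuantumFields.YangMills.Theorems.Prop7TPrint
open Summit.QuantumFields.YangMills.Theorems.Prop7SPrint
open Summit.QuantumFields.YangMills.Theorems.Prop7PV3CDELogChart (in19_expHermField_of_nMax19_lt nMax19_lt_of_in19 eq_expHermField_of_in19)
open Summit.QuantumFields.YangMills.Theorems.Prop7B8Prop7Div (regPr_emb15_of_in19)
open Summit.QuantumFields.YangMills.Theorems.Prop7ChartPrint (axialRepr_print_based_uniform)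

variable {L : ℕ}

/-- ★★ **ROUTE (α) SPINE v2ˢ-CTR — `stub_existenceMinimalOrbit` ⇐ C-minˢ(with `Lift`) ∧ COV ∧ SYM-CENTRE**: ✓`existenceMinimalOrbit_of_CminG_cov` with ONE antecedent `Lift i U₀ →`
inserted in `hC` after `CloseAvg … V U₀ →` and the re-centring row `hS` («some `U₀* ∈ 𝔅_k(V) ∩ 𝔘_k(L³B₃ε₁)` carries `Lift`», window `aS`); the minimiser is built at the centre `U₀*`,
competitors are charted at `U₀*` by COV; `a₁′ := min a₁′ aS`; everything else VERBATIM.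
[cite: Balaban1985Variational, Prop. 7 p.299, (112) p.294, (116) p.295, (141)-(142) p.299; Balaban1985RegularSpaces, Thm 2 p.83, (1.19) p.79, (1.28)-(1.30) p.81] -/
theorem existenceMinimalOrbit_of_CminG_covCtr (hL : 1 < L) {B₃ : ℝ} (hB₃ : 4 < B₃) (Lan : ∀ i : Idx L, GaugeField (i.1.1.P i.1.2.2) 0 (Matrix.specialUnitaryGroup (Fin 2) ℂ) → (PBond (i.1.1.P i.1.2.2) 0 → Matrix (Fin 2) (Fin 2) ℂ) → Prop)
    (Lift : ∀ i : Idx L, GaugeField (i.1.1.P i.1.2.2) 0 (Matrix.specialUnitaryGroup (Fin 2) ℂ) → Prop)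
    (hC : ∃ B₀ a₄ : ℝ, 0 < B₀ ∧ 0 < a₄ ∧ ∀ (i : Idx L) (ε₁ ε₄ : ℝ), 0 < ε₁ → ε₄ ≤ a₄ → 2 * B₀ * (L : ℝ) ^ 3 * B₃ * ε₁ ≤ ε₄ →
        ∀ (V : GaugeField (i.1.1.P i.1.2.1) 0 (Matrix.specialUnitaryGroup (Fin 2) ℂ)) (U₀ : GaugeField (i.1.1.P i.1.2.2) 0 (Matrix.specialUnitaryGroup (Fin 2) ℂ)),
          PlaqSmall ε₁ V → RegPr i.1.1 i.1.2.1 i.1.2.2 ((L : ℝ) ^ 3 * B₃ * ε₁) U₀ → CloseAvg i.1.1 i.1.2.1 i.1.2.2 i.2.2.le ((L : ℝ) ^ 3 * ε₁) V U₀ → Lift i U₀ →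
          ∃ X : PBond (i.1.1.P i.1.2.2) 0 → Matrix (Fin 2) (Fin 2) ℂ,
            nMax19 i.1.1 i.1.2.1 i.1.2.2 U₀ X < 3 * B₀ * (L : ℝ) ^ 3 * B₃ * ε₁ ∧ (∀ b : PBond (i.1.1.P i.1.2.2) 0, (X b).IsHermitian ∧ Matrix.trace (X b) = 0) ∧
            AvgCondPrintS i.1.1 i.1.2.1 i.1.2.2 i.2.2.le V U₀ X ∧ Lan i U₀ X ∧
            ∀ X' : PBond (i.1.1.P i.1.2.2) 0 → Matrix (Fin 2) (Fin 2) ℂ, nMax19 i.1.1 i.1.2.1 i.1.2.2 U₀ X' < ε₄ → (∀ b : PBond (i.1.1.P i.1.2.2) 0, (X' b).IsHermitian ∧ Matrix.trace (X' b) = 0) →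
              AvgCondPrint i.1.1 i.1.2.1 i.1.2.2 i.2.2.le V U₀ X' → IsLandauPrint i.1.1 i.1.2.1 i.1.2.2 U₀ X' →
                wilsonAction4 (emb15 U₀ (expHermField X)) ≤ wilsonAction4 (emb15 U₀ (expHermField X')))
    (hV : ∃ B₁ c₁ : ℝ, 0 < B₁ ∧ 0 < c₁ ∧ ∀ (F : T3Family) (hF : F.L = L) (n K : ℕ) (hnK : n < K) (ε₀ ε₁ ε₂ : ℝ), 0 < ε₀ → 0 < ε₁ →
        ε₀ + (L : ℝ) ^ 3 * ε₁ ≤ c₁ → B₁ * (ε₀ + (L : ℝ) ^ 3 * ε₁) ≤ ε₂ →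
        ∀ (V : GaugeField (F.P n) 0 (Matrix.specialUnitaryGroup (Fin 2) ℂ)) (U₀ : GaugeField (F.P K) 0 (Matrix.specialUnitaryGroup (Fin 2) ℂ)),
          RegPr F n K ((L : ℝ) ^ 3 * B₃ * ε₁) U₀ → CloseAvg F n K hnK.le ((L : ℝ) ^ 3 * ε₁) V U₀ →
          ∀ U : GaugeField (F.P K) 0 (Matrix.specialUnitaryGroup (Fin 2) ℂ), U ∈ regFibrePr F n K hnK.le ε₀ V → IsAxialPrint F n K U₀ U →
            ∃ (u : GaugeTransf (F.P K) 0 (Matrix.specialUnitaryGroup (Fin 2) ℂ)) (U₁ : GaugeField (F.P K) 0 (Matrix.specialUnitaryGroup (Fin 2) ℂ))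
              (X : PBond (F.P K) 0 → Matrix (Fin 2) (Fin 2) ℂ),
              RestrictedPrint F n K U₀ u ∧ GaugeField.gaugeAct u (emb15 U₀ U₁) = U ∧ In19 F n K ε₂ U₀ U₁ X ∧
                AvgCondPrint F n K hnK.le V U₀ X ∧ IsLandauPrint F n K U₀ X)
    -- SYM-CENTRE (displayed): inside the fibre of `V`, next to any admissible `U₀`, some centre `U₀*` carries the lift (ONE radius `L³B₃ε₁`)
    (hS : ∃ aS : ℝ, 0 < aS ∧ ∀ (i : Idx L) (ε₁ : ℝ), 0 < ε₁ → ε₁ ≤ aS →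
        ∀ (V : GaugeField (i.1.1.P i.1.2.1) 0 (Matrix.specialUnitaryGroup (Fin 2) ℂ)) (U₀ : GaugeField (i.1.1.P i.1.2.2) 0 (Matrix.specialUnitaryGroup (Fin 2) ℂ)),
          PlaqSmall ε₁ V → RegPr i.1.1 i.1.2.1 i.1.2.2 ((L : ℝ) ^ 3 * B₃ * ε₁) U₀ → U₀ ∈ fibre i.1.1 ℰp i.1.2.1 i.1.2.2 i.2.2.le V →
          ∃ U₁ : GaugeField (i.1.1.P i.1.2.2) 0 (Matrix.specialUnitaryGroup (Fin 2) ℂ),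
            U₁ ∈ fibre i.1.1 ℰp i.1.2.1 i.1.2.2 i.2.2.le V ∧ RegPr i.1.1 i.1.2.1 i.1.2.2 ((L : ℝ) ^ 3 * B₃ * ε₁) U₁ ∧ Lift i U₁) :
    ∃ a₁' O₁ : ℝ, 0 < a₁' ∧ 1 ≤ O₁ ∧
    ∀ (F : T3Family), F.L = L → ∀ (n K : ℕ) (hnK : n < K) (ε₁ : ℝ), 0 < ε₁ →
      ∀ V : GaugeField (F.P n) 0 (Matrix.specialUnitaryGroup (Fin 2) ℂ), PlaqSmall ε₁ V →
        ∀ U₀ : GaugeField (F.P K) 0 (Matrix.specialUnitaryGroup (Fin 2) ℂ), RegPr F n K ((L : ℝ) ^ 3 * B₃ * ε₁) U₀ → U₀ ∈ fibre F ℰp n K hnK.le V →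
          ε₁ ≤ a₁' → ∃ U ∈ regFibrePr F n K hnK.le (O₁ * (L : ℝ) ^ 3 * B₃ * ε₁) V,
            IsMinOn (fun W : GaugeField (F.P K) 0 (Matrix.specialUnitaryGroup (Fin 2) ℂ) => wilsonAction4 W)
              (regFibrePr F n K hnK.le (O₁ * (L : ℝ) ^ 3 * B₃ * ε₁) V) U := by
  have hL1 : (1 : ℝ) ≤ (L : ℝ) := by exact_mod_cast hL.le
  have hC₁ : (1 : ℝ) ≤ (L : ℝ) ^ 3 := one_le_pow₀ hL1
  have hC₁pos : (0 : ℝ) < (L : ℝ) ^ 3 := by positivity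
  have hB₃0 : 0 < B₃ := by linarith
  have hB₃1 : 1 ≤ B₃ := by linarith
  have hC0 : 0 < C0 3 := C0_pos _
  have hc2 : 0 < c2' 3 L := c2'_pos _ _ hL.le
  set eax : ℝ := min (1 / (6 * C0 3 * (L : ℝ) ^ 3)) (c2' 3 L / (4 * (L : ℝ) ^ 3)) with heax_def
  have heax : 0 < eax := lt_min (by positivity) (by positivity)
  obtain ⟨B₀, a₄, hB₀, ha₄, HC⟩ := hC
  obtain ⟨B₁, c₁, hB₁, hc₁, HV⟩ := hV
  obtain ⟨aS, haS, HS⟩ := hS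
  set M : ℝ := max 1 (3 * B₀) with hM
  have hM1 : 1 ≤ M := le_max_left _ _
  have hM3 : 3 * B₀ ≤ M := le_max_right _ _
  have hM0 : 0 < M := lt_of_lt_of_le one_pos hM1
  have hK₁ : 0 < 2 * B₀ * (L : ℝ) ^ 3 * B₃ := by positivity
  have hK₂ : 0 < B₁ * (178 * M + 1) * (L : ℝ) ^ 3 * B₃ := by positivity
  have hK₃ : 0 < (178 * M + 1) * (L : ℝ) ^ 3 * B₃ := by positivity
  have hK₄ : 0 < 178 * M * (L : ℝ) ^ 3 * B₃ := by positivity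
  have hK₅ : 0 < M * (L : ℝ) ^ 3 * B₃ := by positivity
  set a₁' : ℝ := min (min (min (min (a₄ / (2 * B₀ * (L : ℝ) ^ 3 * B₃)) (a₄ / (B₁ * (178 * M + 1) * (L : ℝ) ^ 3 * B₃))) (c₁ / ((178 * M + 1) * (L : ℝ) ^ 3 * B₃)))
    (eax / (178 * M * (L : ℝ) ^ 3 * B₃))) ((1 / 4) / (M * (L : ℝ) ^ 3 * B₃)) with ha₁'
  have ha₁'0 : 0 < a₁' :=
    lt_min (lt_min (lt_min (lt_min (div_pos ha₄ hK₁) (div_pos ha₄ hK₂)) (div_pos hc₁ hK₃)) (div_pos heax hK₄)) (div_pos (by norm_num) hK₅)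
  refine ⟨min a₁' aS, 178 * M, lt_min ha₁'0 haS, le_trans hM1 (le_mul_of_one_le_left hM0.le (by norm_num)), ?_⟩
  intro F hF n K hnK ε₁ hε₁ V hVreg U₀' hU₀' hB' hε₁aS
  -- SYM-CENTRE: move to a centre `U₀` in the same fibre that carries the lift
  have hε₁a : ε₁ ≤ a₁' := hε₁aS.trans (min_le_left _ _)
  obtain ⟨U₀, hB, hU₀, hLiftU₀⟩ := HS ⟨(F, n, K), hF, hnK⟩ ε₁ hε₁ (hε₁aS.trans (min_le_right _ _)) V U₀' hVreg hU₀' hB'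
  -- the five smallness facts carried by `ε₁ ≤ a₁'`
  have h1 : ε₁ ≤ a₄ / (2 * B₀ * (L : ℝ) ^ 3 * B₃) := hε₁a.trans ((min_le_left _ _).trans ((min_le_left _ _).trans ((min_le_left _ _).trans (min_le_left _ _))))
  have h2 : ε₁ ≤ a₄ / (B₁ * (178 * M + 1) * (L : ℝ) ^ 3 * B₃) :=
    hε₁a.trans ((min_le_left _ _).trans ((min_le_left _ _).trans ((min_le_left _ _).trans (min_le_right _ _))))
  have h3 : ε₁ ≤ c₁ / ((178 * M + 1) * (L : ℝ) ^ 3 * B₃) := hε₁a.trans ((min_le_left _ _).trans ((min_le_left _ _).trans (min_le_right _ _)))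
  have h4 : ε₁ ≤ eax / (178 * M * (L : ℝ) ^ 3 * B₃) := hε₁a.trans ((min_le_left _ _).trans (min_le_right _ _))
  have h5 : ε₁ ≤ (1 / 4) / (M * (L : ℝ) ^ 3 * B₃) := hε₁a.trans (min_le_right _ _)
  have h2B : 2 * B₀ * (L : ℝ) ^ 3 * B₃ * ε₁ ≤ a₄ := by have := (le_div_iff₀ hK₁).1 h1; linarith
  have hε₂a₄ : B₁ * (178 * M * (L : ℝ) ^ 3 * B₃ * ε₁ + (L : ℝ) ^ 3 * ε₁) ≤ a₄ := by
    have := (le_div_iff₀ hK₂).1 h2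
    have h0 : (L : ℝ) ^ 3 * ε₁ ≤ (L : ℝ) ^ 3 * B₃ * ε₁ := by
      have := mul_le_mul_of_nonneg_right (le_mul_of_one_le_right hC₁pos.le hB₃1) hε₁.le; exact this
    nlinarith
  have hsum : 178 * M * (L : ℝ) ^ 3 * B₃ * ε₁ + (L : ℝ) ^ 3 * ε₁ ≤ c₁ := by
    have := (le_div_iff₀ hK₃).1 h3
    have h0 : (L : ℝ) ^ 3 * ε₁ ≤ (L : ℝ) ^ 3 * B₃ * ε₁ := by
      have := mul_le_mul_of_nonneg_right (le_mul_of_one_le_right hC₁pos.le hB₃1) hε₁.le; exact this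
    nlinarith
  have heeax : 178 * M * (L : ℝ) ^ 3 * B₃ * ε₁ ≤ eax := by have := (le_div_iff₀ hK₄).1 h4; linarith
  have hquarter : M * (L : ℝ) ^ 3 * B₃ * ε₁ ≤ 1 / 4 := by have := (le_div_iff₀ hK₅).1 h5; linarith
  -- the (14)-hypotheses at the carrier (`U₀ ∈ 𝔅_k(V)`: b-clause for every b > 0)
  obtain ⟨hreg, hclose⟩ := sat14T3_of_mem_fibre (h := hnK.le) (mul_pos hC₁pos hε₁) hU₀ hB
  -- C-min at ε₄ = a₄: the minimising solution `X`
  obtain ⟨X, hX3, hXh, h20, h21, hXmin⟩ := HC ⟨(F, n, K), hF, hnK⟩ ε₁ a₄ hε₁ le_rfl h2B V U₀ hVreg hreg hclose hLiftU₀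
  -- (112) ⇒ (19) at M·L³B₃ε₁; its axial representative from (20); row D's engine ⇒ W ∈ 𝔘_k(e), e = 178·M·L³B₃ε₁
  have hP0 : 0 ≤ (L : ℝ) ^ 3 * B₃ * ε₁ := by positivity
  have h19 : In19 F n K (M * (L : ℝ) ^ 3 * B₃ * ε₁) U₀ (expHermField X) X := by
    have hmono : 3 * B₀ * (L : ℝ) ^ 3 * B₃ * ε₁ ≤ M * (L : ℝ) ^ 3 * B₃ * ε₁ :=
      calc 3 * B₀ * (L : ℝ) ^ 3 * B₃ * ε₁ = (3 * B₀) * ((L : ℝ) ^ 3 * B₃ * ε₁) := by ring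
        _ ≤ M * ((L : ℝ) ^ 3 * B₃ * ε₁) := mul_le_mul_of_nonneg_right hM3 hP0
        _ = M * (L : ℝ) ^ 3 * B₃ * ε₁ := by ring
    exact in19_expHermField_of_nMax19_lt hXh (lt_of_lt_of_le hX3 hmono)
  have hlo : (L : ℝ) ^ 3 * B₃ * ε₁ ≤ M * (L : ℝ) ^ 3 * B₃ * ε₁ :=
    calc (L : ℝ) ^ 3 * B₃ * ε₁ = 1 * ((L : ℝ) ^ 3 * B₃ * ε₁) := (one_mul _).symm
      _ ≤ M * ((L : ℝ) ^ 3 * B₃ * ε₁) := mul_le_mul_of_nonneg_right hM1 hP0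
      _ = M * (L : ℝ) ^ 3 * B₃ * ε₁ := by ring
  obtain ⟨u, _hu, hWfib⟩ := h20 (expHermField X) h19.2.1
  have he0 : 0 < 178 * (M * (L : ℝ) ^ 3 * B₃ * ε₁) := by positivity
  have hRegW : RegPr F n K (178 * (M * (L : ℝ) ^ 3 * B₃ * ε₁)) (GaugeField.gaugeAct u (emb15 U₀ (expHermField X))) :=
    (regPr_gaugeAct_iff F he0.le u _).mpr (regPr_emb15_of_in19 (F := F) (n := n) (K := K) hquarter hlo hreg h19)
  have hWmem : GaugeField.gaugeAct u (emb15 U₀ (expHermField X)) ∈ regFibrePr F n K hnK.le (178 * (M * (L : ℝ) ^ 3 * B₃ * ε₁)) V :=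
    (mem_regFibrePr_iff F).mpr ⟨hWfib, hRegW⟩
  have hO : 178 * M * (L : ℝ) ^ 3 * B₃ * ε₁ = 178 * (M * (L : ℝ) ^ 3 * B₃ * ε₁) := by ring
  refine ⟨GaugeField.gaugeAct u (emb15 U₀ (expHermField X)), by rw [hO]; exact hWmem, ?_⟩
  rw [hO]
  -- a competitor `U ∈ (6)(e) ∩ 𝔅_k(V)`: axial gauge inside its (4)-orbit, COV's chart, gauge invariance of (5)
  intro U hU
  have h14 : Sat14T3 F n K hnK.le ((L : ℝ) ^ 3 * B₃ * ε₁) ((L : ℝ) ^ 3 * ε₁) V U₀ := ⟨hreg, hclose⟩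
  have hεe : 178 * (M * (L : ℝ) ^ 3 * B₃ * ε₁) ≤ min (1 / (6 * C0 3 * (L : ℝ) ^ 3)) (c2' 3 L / (4 * (L : ℝ) ^ 3)) := by
    rw [← heax_def, ← hO]; exact heeax
  have hB₃e : B₃ * ε₁ ≤ 178 * (M * (L : ℝ) ^ 3 * B₃ * ε₁) := by
    have h0 : B₃ * ε₁ ≤ (L : ℝ) ^ 3 * B₃ * ε₁ := by
      rw [mul_assoc]; exact le_mul_of_one_le_left (by positivity) hC₁
    have h178 : (1 : ℝ) ≤ 178 * M := le_trans hM1 (le_mul_of_one_le_left hM0.le (by norm_num))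
    have h1' : (L : ℝ) ^ 3 * B₃ * ε₁ ≤ 178 * (M * (L : ℝ) ^ 3 * B₃ * ε₁) :=
      calc (L : ℝ) ^ 3 * B₃ * ε₁ = 1 * ((L : ℝ) ^ 3 * B₃ * ε₁) := (one_mul _).symm
        _ ≤ (178 * M) * ((L : ℝ) ^ 3 * B₃ * ε₁) := mul_le_mul_of_nonneg_right h178 (by positivity)
        _ = 178 * (M * (L : ℝ) ^ 3 * B₃ * ε₁) := by ring
    exact h0.trans h1'
  obtain ⟨v, hv, hvAx⟩ := axialRepr_print_based_uniform F hF hnK.le hC₁ B₃ _ ε₁ V U₀ U hεe hB₃e h14 hU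
  have hUv : GaugeField.gaugeAct v U ∈ regFibrePr F n K hnK.le (178 * (M * (L : ℝ) ^ 3 * B₃ * ε₁)) V :=
    (gaugeAct_mem_regFibrePr_iff_of_trivial F hnK.le he0.le hv U V).mpr hU
  have hUvax : IsAxialPrint F n K U₀ (GaugeField.gaugeAct v U) := hvAx _
  have hsum' : 178 * (M * (L : ℝ) ^ 3 * B₃ * ε₁) + (L : ℝ) ^ 3 * ε₁ ≤ c₁ := by rw [← hO]; exact hsum
  obtain ⟨u', U₁', X', _hu', hUeq, h19', h20', h21'⟩ :=
    HV F hF n K hnK _ ε₁ (B₁ * (178 * (M * (L : ℝ) ^ 3 * B₃ * ε₁) + (L : ℝ) ^ 3 * ε₁)) he0 hε₁ hsum' le_rfl V U₀ hreg hclose (GaugeField.gaugeAct v U) hUv hUvax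
  have hX'a₄ : nMax19 F n K U₀ X' < a₄ := nMax19_lt_of_in19 h19' (by rw [← hO]; exact hε₂a₄)
  have hcmp := hXmin X' hX'a₄ h19'.1 h20' h21'
  -- gauge invariance of (5): A(W) = A(e^{iX}U₀) ≤ A(e^{iX′}U₀) = A((e^{iX′}U₀)^{u′}) = A(U^v) = A(U)
  have e₁' : U₁' = expHermField X' := eq_expHermField_of_in19 h19'
  have a1 : wilsonAction4 (GaugeField.gaugeAct u (emb15 U₀ (expHermField X))) = wilsonAction4 (emb15 U₀ (expHermField X)) :=
    T4WilsonGaugeFlatDirection.wilsonAction_gaugeAct 1 u _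
  have a2 : wilsonAction4 (GaugeField.gaugeAct v U) = wilsonAction4 U := T4WilsonGaugeFlatDirection.wilsonAction_gaugeAct 1 v U
  have a3 : wilsonAction4 (GaugeField.gaugeAct u' (emb15 U₀ U₁')) = wilsonAction4 (emb15 U₀ U₁') :=
    T4WilsonGaugeFlatDirection.wilsonAction_gaugeAct 1 u' _
  have a4 : wilsonAction4 (emb15 U₀ U₁') = wilsonAction4 U := by rw [← a3, hUeq, a2]
  have a5 : wilsonAction4 (emb15 U₀ (expHermField X')) = wilsonAction4 U := by rw [← e₁']; exact a4
  show wilsonAction4 (GaugeField.gaugeAct u (emb15 U₀ (expHermField X))) ≤ wilsonAction4 U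
  rw [a1, ← a5]
  exact hcmp

end Summit.QuantumFields.YangMills.Theorems.Prop7ExistRouteAlphaMinGCtr

end
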